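import Summits.KontsevichZagierPeriods.KontsevichZagierPeriods.Theorems.HurwitzMicroSectorsNormalFormPrincipleLevelOne
import Summits.KontsevichZagierPeriods.KontsevichZagierPeriods.Theorems.HurwitzMicroSectorsNormalFormPrincipleSlabASubPtK20
import Summits.KontsevichZagierPeriods.KontsevichZagierPeriods.Theorems.HurwitzMicroSectorsNormalFormPrincipleAlgCarriers
import Summits.KontsevichZagierPeriods.KontsevichZagierPeriods.Theorems.HurwitzMicroSectorsNormalFormPrincipleM2FiveZetaTwo

/-!
# `NormalFormPrinciple` (stmt-KontsevichZagierPeriods-3869), line `SketchIdeator1` — leaf `stub_boxRigidity`: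
# all weights, level `K`, totally off resonance: integrating out the last coordinate over `[t/P, 1]` (rule 3)

Registered sub-goal `stokesN` of the layer "Conjecture 1 for the weight-`w` level-`K` boxes
`[(0,1)^w, c (Π_l x_l^{e_l})/(1 − Π_l x_l^K)]` with pairwise distinct exponents" (lead file
`…WeightN`), the dimension-generic version of the weight-three move `…W3Stokes`. After merging
`t = Π x_l` and re-banding, one is left with the nested band representation `R' = [Σ, h]` over the
base `B = {w ∈ ℝⁿ⁺¹ : 0 < w_i < 1 (i < n), 0 ≤ w_n ≤ P(w)}`, `P(w) = Π_{i<n} w_i` (the domain of the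
band `R_n`, `t = w_n` its last coordinate), with fibre `[w_n/P(w), 1]` in the last coordinate `y`
and integrand `h(w, y) = c (Π_{i<n} w_i^{A_i}) y^{A_n} w_n^D/(1 − w_n^K)`, `A_n + 1 ≤ A_i`, `c` real
algebraic. ONE Newton–Leibniz move (rule 3, `KZ.newtonLeibnizRel`) along the last coordinate with
the primitive `F(w, y) = (c/(A_n+1)) (Π_{i<n} w_i^{A_i}) y^{A_n+1} w_n^D/(1 − w_n^K)` (`∂F/∂y = h`)
replaces `R'` by the base representation `T = [B, F(·,1) − F(·, w_n/P)]`, and the endpoint identity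
`F(w,1) − F(w,w_n/P) = (c/(A_n+1)) ((Π w_i^{A_i}) w_n^D − (Π w_i^{A_i−A_n−1}) w_n^{D+A_n+1})/(1 − w_n^K)`
holds because `(Π w_i^{A_i}) (w_n/P)^{A_n+1} = (Π w_i^{A_i−A_n−1}) w_n^{A_n+1}` for `w_i ≠ 0`,
`A_n + 1 ≤ A_i`. The primitive is `ℚ`-semialgebraic on `Σ` (algebraic constant times a quotient of
`ℚ`-polynomials where `1 − w_n^K ≠ 0`, glued with the zero function where `1 − w_n^K = 0` — Lean's
`x/0 = 0`; this only matters for `n = 0`, where `B = [0,1]`), the lower edge `w ↦ w_n/P(w)` is a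
quotient of `ℚ`-polynomials on `B` (`P > 0` there), and `w_n/P(w) ≤ 1` on `B`.

References: M. Kontsevich, D. Zagier, *Periods* (2001), §1.2 rule (3). No new definitions.
-/

noncomputable section

open MeasureTheory Set
open Literature.NumberTheory.Transcendental Literature.NumberTheory.Transcendental.KZ
open Literature.ModelTheory.ExponentialFields (IsSemialgebraic)

namespace Summit.KontsevichZagierPeriods.HurwitzMicroSectors.NormalFormPrinciple.PiBox.WeightN

/-! ### Semialgebraicity with an algebraic coefficient, the primitive along the last coordinate -/

/-- On a `ℚ`-semialgebraic set `B ⊆ ℝⁿ`, the function `w ↦ c · p(w)/(1 − wᵢ^K)` with `p ∈ ℚ[w]` and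
`c` real algebraic is `ℚ`-semialgebraic, with Lean's convention `x/0 = 0` where the denominator
vanishes: on `B ∩ {1 − wᵢ^K ≠ 0}` it is the algebraic constant `c`
(`isSemialgebraicFunOn_const_of_isAlgebraic`) times a quotient of `ℚ`-polynomials, on
`B ∩ {1 − wᵢ^K = 0}` it is the zero function, and the two pieces glue
(`IsSemialgebraicFunOn.union`). [cite: BochnakCosteRoy1998, Prop. 2.2.6] -/
theorem wn_stokes_isSemialgebraicFunOn {n : ℕ} (K : ℕ) (i : Fin n) {B : Set (Fin n → ℝ)}
    (hB : IsSemialgebraic ℚ B) {c : ℝ} (hc : IsAlgebraic ℚ c) (p : MvPolynomial (Fin n) ℚ) :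
    IsSemialgebraicFunOn ℚ B (fun w => c * MvPolynomial.aeval w p / (1 - w i ^ K)) := by
  have hq : ∀ w : Fin n → ℝ,
      MvPolynomial.aeval w (1 - MvPolynomial.X i ^ K : MvPolynomial (Fin n) ℚ) = 1 - w i ^ K :=
    fun w => by simp only [map_sub, map_one, map_pow, MvPolynomial.aeval_X]
  -- the piece where the denominator does not vanish
  have h₁ : IsSemialgebraic ℚ (B ∩ {w : Fin n → ℝ |
      MvPolynomial.aeval w (1 - MvPolynomial.X i ^ K : MvPolynomial (Fin n) ℚ) ≠ 0}) :=
    hB.inter (Literature.ModelTheory.ExponentialFields.isSemialgebraic_setOf_eval_ne_zero _)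
  -- the piece where it vanishes
  have h₂ : IsSemialgebraic ℚ (B ∩ {w : Fin n → ℝ |
      MvPolynomial.aeval w (1 - MvPolynomial.X i ^ K : MvPolynomial (Fin n) ℚ) = 0}) :=
    hB.inter (Literature.ModelTheory.ExponentialFields.isSemialgebraic_setOf_eval_eq_zero _)
  have hF₁ : IsSemialgebraicFunOn ℚ (B ∩ {w : Fin n → ℝ |
      MvPolynomial.aeval w (1 - MvPolynomial.X i ^ K : MvPolynomial (Fin n) ℚ) ≠ 0})
      (fun w => c * MvPolynomial.aeval w p / (1 - w i ^ K)) := by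
    refine (IsSemialgebraicFunOn.mul_holds (isSemialgebraicFunOn_const_of_isAlgebraic h₁ hc)
      (isSemialgebraicFunOn_aeval_div_aeval h₁ p (1 - MvPolynomial.X i ^ K)
        fun w hw => hw.2)).congr fun w _ => ?_
    simp only [Pi.mul_apply, hq]
    exact (mul_div_assoc _ _ _).symm
  have hF₂ : IsSemialgebraicFunOn ℚ (B ∩ {w : Fin n → ℝ |
      MvPolynomial.aeval w (1 - MvPolynomial.X i ^ K : MvPolynomial (Fin n) ℚ) = 0})
      (fun w => c * MvPolynomial.aeval w p / (1 - w i ^ K)) := by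
    refine (isSemialgebraicFunOn_ratCast h₂ 0).congr fun w hw => ?_
    have h0 : 1 - w i ^ K = 0 := (hq w).symm.trans hw.2
    simp only [h0, div_zero, Rat.cast_zero]
  exact (hF₁.union hF₂ (fun _ _ => rfl) fun _ _ => rfl).mono
    (fun w hw => (ne_or_eq _ _).imp (And.intro hw) (And.intro hw)) hB

/-- The derivative in `y` of the primitive `y ↦ (c/(m+1)) P y^{m+1} u^D/(1 − u^K)` is the integrand
`c P y^m u^D/(1 − u^K)` (`c, P, u` real constants: `P = Π_{i<n} w_i^{A_i}`, `u = w_n`). [folklore] -/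
theorem wn_stokes_hasDerivAt (K D m : ℕ) (c P u t : ℝ) :
    HasDerivAt (fun s : ℝ => c / ((m + 1 : ℕ) : ℝ) * (P * s ^ (m + 1) * u ^ D) / (1 - u ^ K))
      (c * P * t ^ m * u ^ D / (1 - u ^ K)) t := by
  have hne : ((m + 1 : ℕ) : ℝ) ≠ 0 := Nat.cast_ne_zero.2 (Nat.succ_ne_zero m)
  have h := ((((hasDerivAt_pow (m + 1) t).const_mul P).mul_const (u ^ D)).const_mul
    (c / ((m + 1 : ℕ) : ℝ))).div_const (1 - u ^ K)
  refine h.congr_deriv ?_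
  rw [Nat.add_sub_cancel]
  congr 1
  field_simp

/-- The endpoint identity of the Newton–Leibniz move: for `m + 1 ≤ B_i`, `y_i ≠ 0` and `c`, `u`
real, `(c/(m+1)) ((Π y_i^{B_i}) u^D − (Π y_i^{B_i−m−1}) u^{D+m+1})/(1 − u^K) = F(y,u,1) − F(y,u,u/Π y_i)`
with `F(y,u,s) = (c/(m+1)) (Π y_i^{B_i}) s^{m+1} u^D/(1 − u^K)`, because
`(Π y_i^{B_i}) (u/Π y_i)^{m+1} = (Π y_i^{B_i−m−1}) u^{m+1}`. [folklore] -/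
theorem wn_stokes_endpoint {n : ℕ} (K D m : ℕ) (B : Fin n → ℕ) (hB : ∀ i, m + 1 ≤ B i) (c : ℝ)
    (y : Fin n → ℝ) (hy : ∀ i, y i ≠ 0) (u : ℝ) :
    c / ((m + 1 : ℕ) : ℝ) * ((∏ i, y i ^ B i) * u ^ D -
        (∏ i, y i ^ (B i - m - 1)) * u ^ (D + m + 1)) / (1 - u ^ K) =
      c / ((m + 1 : ℕ) : ℝ) * ((∏ i, y i ^ B i) * (1:ℝ) ^ (m + 1) * u ^ D) / (1 - u ^ K) -
        c / ((m + 1 : ℕ) : ℝ) * ((∏ i, y i ^ B i) * (u / ∏ i, y i) ^ (m + 1) * u ^ D) /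
          (1 - u ^ K) := by
  have hP : (∏ i, y i ^ B i) = (∏ i, y i ^ (B i - m - 1)) * ∏ i, y i ^ (m + 1) := by
    rw [← Finset.prod_mul_distrib]
    exact Finset.prod_congr rfl fun i _ => by
      rw [← pow_add, Nat.sub_sub, Nat.sub_add_cancel (hB i)]
  have hP0 : (∏ i, y i ^ (m + 1)) ≠ 0 :=
    Finset.prod_ne_zero_iff.2 fun i _ => pow_ne_zero _ (hy i)
  have key : (∏ i, y i ^ B i) * (u / ∏ i, y i) ^ (m + 1) =
      (∏ i, y i ^ (B i - m - 1)) * u ^ (m + 1) := by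
    rw [div_pow, ← Finset.prod_pow, hP, mul_div_assoc', mul_right_comm,
      mul_div_cancel_right₀ _ hP0]
  rw [one_pow, mul_one, key]
  ring

/-! ### The stub -/

/-- **N5 (integrating out the last coordinate `y ∈ [w_n/Π_{i<n} w_i, 1]`, rule 3; registered
sub-goal of the all-weights totally-off-resonance layer of `stub_boxRigidity`).** For `K ≥ 1`,
exponents `A : Fin (n+1) → ℕ` with `A_n + 1 ≤ A_i` (`i < n`, `A_n := A (last n)`) and
`c ∈ ℚ̄ ∩ ℝ`, the nested band representation
`R' = [{0 < w_i < 1 (i < n), 0 ≤ w_n ≤ Π_{i<n} w_i, w_n/Π_{i<n} w_i ≤ y ≤ 1},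
  c (Π_{i<n} w_i^{A_i}) y^{A_n} w_n^D/(1 − w_n^K)]` (coordinates `(w_0,…,w_n,y)`, `w_n = t`) and the
base representation
`T = [{0 < w_i < 1, 0 ≤ w_n ≤ Π w_i}, (c/(A_n+1)) ((Π w_i^{A_i}) w_n^D − (Π w_i^{A_i−A_n−1}) w_n^{D+A_n+1})/(1 − w_n^K)]`
differ by ONE Newton–Leibniz relation along the last coordinate, with the primitive
`F = (c/(A_n+1)) (Π w_i^{A_i}) y^{A_n+1} w_n^D/(1 − w_n^K)`: `∂F/∂y` is the integrand of `R'` and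
`F(·,1) − F(·,w_n/Π w_i)` is the integrand of `T`. [cite: KontsevichZagier2001, §1.2 rule (3)] -/
theorem stokesN (n : ℕ) (K : ℕ) (hK : 0 < K) (A : Fin (n + 1) → ℕ) (D : ℕ)
    (hA : ∀ i : Fin n, A (Fin.last n) + 1 ≤ A (Fin.castSucc i)) (c : ℝ) (hc : IsAlgebraic ℚ c)
    (R' : IntegralRep (n + 2)) (T : IntegralRep (n + 1))
    (hR'd : R'.domain = KZlog.band
      (KZlog.band {y : Fin n → ℝ | ∀ i, y i ∈ Set.Ioo (0:ℝ) 1} (fun _ => (0:ℝ)) (fun y => ∏ i, y i))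
      (fun w => w (Fin.last n) / ∏ i : Fin n, w (Fin.castSucc i)) (fun _ => (1:ℝ)))
    (hR'i : EqOn R'.integrand (fun z =>
        c * (∏ i : Fin n, z (Fin.castSucc (Fin.castSucc i)) ^ (A (Fin.castSucc i))) *
          z (Fin.last (n + 1)) ^ (A (Fin.last n)) * z (Fin.castSucc (Fin.last n)) ^ D /
          (1 - z (Fin.castSucc (Fin.last n)) ^ K)) R'.domain)
    (hTd : T.domain = KZlog.band {y : Fin n → ℝ | ∀ i, y i ∈ Set.Ioo (0:ℝ) 1} (fun _ => (0:ℝ))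
      (fun y => ∏ i, y i))
    (hTi : EqOn T.integrand (fun z => c / ((A (Fin.last n) + 1 : ℕ) : ℝ) *
        ((∏ i : Fin n, z (Fin.castSucc i) ^ (A (Fin.castSucc i))) * z (Fin.last n) ^ D -
         (∏ i : Fin n, z (Fin.castSucc i) ^ (A (Fin.castSucc i) - A (Fin.last n) - 1)) *
           z (Fin.last n) ^ (D + A (Fin.last n) + 1)) / (1 - z (Fin.last n) ^ K)) T.domain) :
    of R' - of T ∈ relations := by
  have _ := hK
  -- the base `B = T.domain = {0 < w_i < 1 (i < n), 0 ≤ w_n ≤ Π_{i<n} w_i} ⊆ ℝⁿ⁺¹`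
  have hτ : IsSemialgebraic ℚ T.domain := T.isSemialgebraic_domain
  have hmemT : ∀ w : Fin (n + 1) → ℝ, w ∈ T.domain ↔
      (∀ i : Fin n, w (Fin.castSucc i) ∈ Ioo (0:ℝ) 1) ∧ 0 ≤ w (Fin.last n) ∧
        w (Fin.last n) ≤ ∏ i : Fin n, w (Fin.castSucc i) := fun w => by
    rw [hTd]
    exact Iff.rfl
  -- the product `P(w) = Π_{i<n} w_i` is positive on `B`
  have hP : ∀ w ∈ T.domain, (0:ℝ) < ∏ i : Fin n, w (Fin.castSucc i) := fun w hw =>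
    Finset.prod_pos fun i _ => (((hmemT w).1 hw).1 i).1
  -- fibrewise membership in the nested band `Σ = R'.domain`
  have hsnoc : ∀ w ∈ T.domain, ∀ t : ℝ, w (Fin.last n) / ∏ i : Fin n, w (Fin.castSucc i) ≤ t →
      t ≤ 1 → (Fin.snoc w t : Fin (n + 2) → ℝ) ∈ R'.domain := fun w hw t h₁ h₂ => by
    rw [hR'd, KZlog.snoc_mem_band, ← hTd]
    exact ⟨hw, h₁, h₂⟩
  -- ONE Newton–Leibniz move along `y = z (last (n+1)) ∈ [w_n/P(w), 1]` over `B`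
  refine newtonLeibnizRel_subset_relations ⟨n + 1, R', T,
    fun w => w (Fin.last n) / ∏ i : Fin n, w (Fin.castSucc i), fun _ => (1:ℝ),
    fun z => c / ((A (Fin.last n) + 1 : ℕ) : ℝ) *
      ((∏ i : Fin n, z (Fin.castSucc (Fin.castSucc i)) ^ (A (Fin.castSucc i))) *
        z (Fin.last (n + 1)) ^ (A (Fin.last n) + 1) * z (Fin.castSucc (Fin.last n)) ^ D) /
      (1 - z (Fin.castSucc (Fin.last n)) ^ K),
    ?_, ?_, (by simpa using isSemialgebraicFunOn_ratCast hτ 1),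
    fun w hw => div_le_one_of_le₀ ((hmemT w).1 hw).2.2 (hP w hw).le, ?_, ?_, ?_, ?_, rfl⟩
  · -- the primitive is `c` times a quotient of `ℚ`-polynomials on the band (glued with `0`)
    refine (wn_stokes_isSemialgebraicFunOn K (Fin.castSucc (Fin.last n))
      R'.isSemialgebraic_domain hc
      (MvPolynomial.C (1 / ((A (Fin.last n) + 1 : ℕ) : ℚ)) *
        ((∏ i : Fin n, MvPolynomial.X (Fin.castSucc (Fin.castSucc i)) ^ (A (Fin.castSucc i))) *
          MvPolynomial.X (Fin.last (n + 1)) ^ (A (Fin.last n) + 1) *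
          MvPolynomial.X (Fin.castSucc (Fin.last n)) ^ D))).congr fun z _ => ?_
    simp only [map_mul, map_prod, map_pow, MvPolynomial.aeval_C, MvPolynomial.aeval_X,
      eq_ratCast, Rat.cast_div, Rat.cast_one, Rat.cast_natCast]
    ring
  · -- the lower edge `w ↦ w_n/P(w)` is a quotient of `ℚ`-polynomials on `B` (`P > 0` there)
    refine (isSemialgebraicFunOn_aeval_div_aeval hτ (MvPolynomial.X (Fin.last n))
      (∏ i : Fin n, MvPolynomial.X (Fin.castSucc i)) fun w hw => ?_).congr fun w _ => by
      simp only [map_prod, MvPolynomial.aeval_X]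
    simpa only [map_prod, MvPolynomial.aeval_X] using (hP w hw).ne'
  · -- the band over `B` with edges `w_n/P(w) ≤ y ≤ 1`
    rw [hR'd, hTd]
    rfl
  · -- continuity of the primitive on the closed fibre
    intro w _
    simp only [Fin.snoc_castSucc, Fin.snoc_last]
    exact (by fun_prop : Continuous fun t : ℝ => c / ((A (Fin.last n) + 1 : ℕ) : ℝ) *
      ((∏ i : Fin n, w (Fin.castSucc i) ^ (A (Fin.castSucc i))) * t ^ (A (Fin.last n) + 1) *
        w (Fin.last n) ^ D) / (1 - w (Fin.last n) ^ K)).continuousOn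
  · -- its derivative on the open fibre is the integrand of `R'`
    intro w hw t ht
    rw [hR'i (hsnoc w hw t ht.1.le ht.2.le)]
    simp only [Fin.snoc_castSucc, Fin.snoc_last]
    exact wn_stokes_hasDerivAt K D (A (Fin.last n)) c _ (w (Fin.last n)) t
  · -- the endpoint difference
    intro w hw
    rw [hTi hw]
    simp only [Fin.snoc_castSucc, Fin.snoc_last]
    exact wn_stokes_endpoint K D (A (Fin.last n)) (fun i => A (Fin.castSucc i)) hA c
      (fun i => w (Fin.castSucc i)) (fun i => (((hmemT w).1 hw).1 i).1.ne') (w (Fin.last n))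

end Summit.KontsevichZagierPeriods.HurwitzMicroSectors.NormalFormPrinciple.PiBox.WeightN
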